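import Mathlib.Analysis.SpecialFunctions.Pow.Real
import Mathlib.Analysis.SpecialFunctions.Exponential
import Mathlib.Analysis.SpecialFunctions.Log.Basic

/-!
# Route `RandomisedStokes` (LINE 18 of seat `ym-r3-idea-2`; rung R3 of LADDER-YM = `T3YM3TorusStatement.YM3TorusSU2`, a RECORD
# rung — not d = 4, not the Clay statement) — THE OFF-SLIVER ENGINE of the glue `HistoryTailOfChaosL` (support item
# stmt-QuantumFields-23887), part 1a: the two off-sliver exponent comparisons (pure real analysis)

The glue `RectangleTailL → ChaosSuppressedDominationL → ThinDeepWindowTailL → UnitScaleTilt.HistoryTailL` needs, OFF THE SLIVER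
`(j+1)^N ≤ p(g_h)` (`h = K − j`, `p = p_{b₀,p₀}`), a per-plaquette tail of the BARE event `{θ_{b₀}(h) ≤ |Ū^{j}(∂p) − 1|}` with a
log-square rate `exp(−(1 + log g_h⁻¹)²)`.  With `η = θ_{b₀}(h)/(2D(j+1))` the event lies in `{not profile-flat} ∪ {flat ∧ D(j+1)η <
|Ū^{j}(∂p) − 1|}` (`real_bare_le_count_mul_add`); the first part is a union over `≤ 288R²L^{3m}(j+1)L^{3K+2j}` rectangle events
(`count_le_offSliver`), each bounded by the rectangle tail (`rect_event_le_offSliver`, exponent lemma `offSliver_rect_exponent`: the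
`j`-entropy is paid inside the stretched exponent because `(j+1) ≤ p^{1/N}` and `N > 3/2 + 1/α`); the second by the chaos crux
(exponent lemma `offSliver_chaos_exponent`: `η/g_h² = p·e^{ℓ}/(2D(j+1))`, `N > 1 + 1/α_X`).  Part 2
(`RandomisedStokesOffSliverEngine.lean`) assembles the off-sliver per-plaquette tail; the glue file lands the item BY NAME.

HONEST FRAMING: bookkeeping only (real analysis + a union bound).  The cruxes `RectangleTailL` (stmt-23864),
`ChaosSuppressedDominationL` (stmt-23885), `ThinDeepWindowTailL` (stmt-23919) stay OPEN; nothing here proves `HistoryTailL`, the rung R3,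
or anything about the Yang–Mills mass gap.  No `def`, no `sorry`.

References: T. Bałaban, CMP **102** (1985) 255–275 [Balaban1985UV3] ((3),(7) p.256–257); C. King, CMP **103** (1986) 323–349 [King1986].
-/

set_option autoImplicit false

noncomputable section

namespace Summit.QuantumFields.YangMills.Theorems.RandomisedStokesChaos

/-! ## §1 The two off-sliver exponent comparisons -/

section Exponent

/-- **OFF-SLIVER EXPONENT, RECTANGLE TERM** (pure real analysis).  Off the sliver — `(j+1)^N ≤ P = p(g_h)` — a rectangle of
perimeter `2 ≤ s ≤ R·L^i`, `i ≤ j`, at threshold `t` with `t²β_K = P²L^i/(4D²(j+1)²)` has rectangle-tail exponent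
`(c·t²β_K/(s(1+log s)))^α ≥ κ(j+1) + u²` (`u² ≤ P^{2/N}`, e.g. `u = 1 + log g_h⁻¹`), provided the profile floor makes
`c₂^α·P^{α(2−3/N)−2/N} ≥ κ + 1`, `c₂ = c/(4D²R(1+log R)(1+log L))`: the `j`-entropy `κ(j+1) ≤ κP^{1/N}` and the log-square rate are
both paid by `P^{2/N}`. [cite: Balaban1985UV3, (7) p.257] -/
theorem offSliver_rect_exponent {α c D R P u logL s Li κ : ℝ} {i j N : ℕ} (hα : 0 < α) (hc : 0 < c)
    (hD : 1 ≤ D) (hR : 2 ≤ R) (hlogL : 1 ≤ logL) (hP1 : 1 ≤ P) (hN : 0 < N)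
    (hjP : ((j : ℝ) + 1) ^ N ≤ P) (huP : u ^ 2 ≤ P ^ ((2 : ℝ) / N)) (hij : i ≤ j) (hLi : 0 < Li)
    (hlogLi : Real.log Li = (i : ℝ) * logL) (hs2 : 2 ≤ s) (hsR : s ≤ R * Li) (hκ : 0 ≤ κ)
    (hbig : κ + 1 ≤ (c / (4 * D ^ 2 * R * (1 + Real.log R) * (1 + logL))) ^ α *
      P ^ (α * (2 - 3 / N) - 2 / N)) :
    κ * ((j : ℝ) + 1) + u ^ 2 ≤ (c * (P ^ 2 * Li / (4 * D ^ 2 * ((j : ℝ) + 1) ^ 2) / (s * (1 + Real.log s)))) ^ α := by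
  have hP0 : 0 < P := by linarith
  have hR0 : 0 < R := by linarith
  have hD0 : 0 < D := by linarith
  have hlogR : 0 ≤ Real.log R := Real.log_nonneg (by linarith)
  have hs0 : 0 < s := by linarith
  have hlogs0 : 0 ≤ Real.log s := Real.log_nonneg (by linarith)
  have hj1 : (0 : ℝ) < (j : ℝ) + 1 := by positivity
  have hNr : (0 : ℝ) < N := by exact_mod_cast hN
  set E : ℝ := 4 * D ^ 2 * R * (1 + Real.log R) * (1 + logL) with hE
  have hE0 : 0 < E := by positivity
  -- (j+1) ≤ P^{1/N}
  have hjP1 : ((j : ℝ) + 1) ≤ P ^ ((N : ℝ)⁻¹) := by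
    have h := Real.rpow_le_rpow (by positivity) hjP (inv_nonneg.mpr hNr.le)
    rwa [Real.pow_rpow_inv_natCast hj1.le hN.ne'] at h
  -- the denominator: s(1+log s) ≤ R Li (1+log R)(1+logL)(j+1)
  have hlogs : Real.log s ≤ Real.log R + (i : ℝ) * logL := by
    have h1 : Real.log s ≤ Real.log (R * Li) := Real.log_le_log hs0 hsR
    rwa [Real.log_mul hR0.ne' hLi.ne', hlogLi] at h1
  have hij' : (i : ℝ) ≤ j := by exact_mod_cast hij
  have hden : s * (1 + Real.log s) ≤ R * Li * ((1 + Real.log R) * (1 + logL) * ((j : ℝ) + 1)) := by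
    have h1 : 1 + Real.log s ≤ (1 + Real.log R) * (1 + logL) * ((j : ℝ) + 1) := by
      have : (i : ℝ) * logL ≤ (j : ℝ) * logL := mul_le_mul_of_nonneg_right hij' (by linarith)
      nlinarith [mul_nonneg hlogR (by linarith : (0:ℝ) ≤ logL), mul_nonneg hlogR hj1.le,
        mul_nonneg (mul_nonneg hlogR (by linarith : (0:ℝ) ≤ logL)) hj1.le]
    exact mul_le_mul hsR h1 (by linarith) (by positivity)
  have hden0 : 0 < s * (1 + Real.log s) := by positivity
  -- the base: c X ≥ (c/E) P² /(j+1)³ ≥ (c/E) P^{2-3/N}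
  have hX : c / E * P ^ (2 - 3 / (N : ℝ)) ≤
      c * (P ^ 2 * Li / (4 * D ^ 2 * ((j : ℝ) + 1) ^ 2) / (s * (1 + Real.log s))) := by
    have hj3 : ((j : ℝ) + 1) ^ 3 ≤ P ^ (3 / (N : ℝ)) := by
      have := pow_le_pow_left₀ hj1.le hjP1 3
      rwa [← Real.rpow_natCast (P ^ ((N : ℝ)⁻¹)) 3, ← Real.rpow_mul hP0.le, inv_mul_eq_div,
        show ((3 : ℕ) : ℝ) = 3 by norm_num] at this
    have hsplit : P ^ (2 - 3 / (N : ℝ)) = P ^ 2 / P ^ (3 / (N : ℝ)) := by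
      rw [Real.rpow_sub hP0, Real.rpow_two]
    calc c / E * P ^ (2 - 3 / (N : ℝ)) = c * (P ^ 2 / (E * P ^ (3 / (N : ℝ)))) := by
          rw [hsplit]; field_simp
      _ ≤ c * (P ^ 2 / (E * ((j : ℝ) + 1) ^ 3)) := by
          refine mul_le_mul_of_nonneg_left ?_ hc.le
          exact div_le_div_of_nonneg_left (by positivity) (by positivity) (mul_le_mul_of_nonneg_left hj3 hE0.le)
      _ = c * (P ^ 2 * Li / (4 * D ^ 2 * ((j : ℝ) + 1) ^ 2) / (R * Li * ((1 + Real.log R) * (1 + logL) * ((j : ℝ) + 1)))) := by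
          rw [hE]; field_simp
      _ ≤ c * (P ^ 2 * Li / (4 * D ^ 2 * ((j : ℝ) + 1) ^ 2) / (s * (1 + Real.log s))) := by
          refine mul_le_mul_of_nonneg_left ?_ hc.le
          exact div_le_div_of_nonneg_left (by positivity) hden0 hden
  have hX0 : 0 ≤ c / E * P ^ (2 - 3 / (N : ℝ)) := by positivity
  -- raise to α
  have hpow := Real.rpow_le_rpow hX0 hX hα.le
  refine le_trans ?_ hpow
  rw [Real.mul_rpow (by positivity) (Real.rpow_nonneg hP0.le _), ← Real.rpow_mul hP0.le]
  -- (c/E)^α P^{(2-3/N)α} = (c/E)^α P^{α(2-3/N) - 2/N} * P^{2/N}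
  have hsplit2 : P ^ ((2 - 3 / (N : ℝ)) * α) = P ^ (α * (2 - 3 / N) - 2 / N) * P ^ ((2 : ℝ) / N) := by
    rw [← Real.rpow_add hP0]; congr 1; ring
  rw [hsplit2, ← mul_assoc]
  have hP2N : ((j : ℝ) + 1) ≤ P ^ ((2 : ℝ) / N) := by
    refine hjP1.trans (Real.rpow_le_rpow_of_exponent_le hP1 ?_)
    rw [inv_eq_one_div]
    exact div_le_div_of_nonneg_right (by norm_num) hNr.le
  have hP2N0 : 0 ≤ P ^ ((2 : ℝ) / N) := Real.rpow_nonneg hP0.le _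
  calc κ * ((j : ℝ) + 1) + u ^ 2 ≤ κ * P ^ ((2 : ℝ) / N) + P ^ ((2 : ℝ) / N) :=
        add_le_add (mul_le_mul_of_nonneg_left hP2N hκ) huP
    _ = (κ + 1) * P ^ ((2 : ℝ) / N) := by ring
    _ ≤ (c / E) ^ α * P ^ (α * (2 - 3 / N) - 2 / N) * P ^ ((2 : ℝ) / N) :=
        mul_le_mul_of_nonneg_right hbig hP2N0

/-- **OFF-SLIVER EXPONENT, CHAOS TERM** (pure real analysis).  Off the sliver (`(j+1)^N ≤ P`), with `η/g_h² = P·e^ℓ/(2D(j+1))`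
(`ℓ = log g_h⁻¹ ≥ 0`), the chaos exponent `(c'·P e^ℓ/(2D(j+1)))^{α_X}` exceeds `A'·j·log L + (1+ℓ)² − M`,
`M = 2 + 8/κ₃²`, `κ₃ = (c'/2D)^{α_X}α_X³/12`, provided `(c'/2D)^{α_X}/2 · P^{α_X(1−1/N)−1/N} ≥ A' log L`: split
`κ_X·x·y ≥ κ_X(x+y)/2` (`x = P^{α_X(1−1/N)} ≥ 1`, `y = e^{α_Xℓ} ≥ 1`), the polynomial half pays the `j`-entropy and
`e^{α_Xℓ} ≥ (α_Xℓ)³/6` pays the square. [cite: Balaban1985UV3, (7) p.257] -/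
theorem offSliver_chaos_exponent {αX c' D P ℓ logL A' : ℝ} {j N : ℕ} (hαX : 0 < αX) (hc' : 0 < c')
    (hD : 1 ≤ D) (hP1 : 1 ≤ P) (hN : 0 < N) (hjP : ((j : ℝ) + 1) ^ N ≤ P) (hℓ : 0 ≤ ℓ) (hlogL : 0 ≤ logL)
    (hA' : 0 ≤ A')
    (hbig : A' * logL ≤ (c' / (2 * D)) ^ αX / 2 * P ^ (αX * (1 - 1 / N) - 1 / N)) :
    A' * ((j : ℝ) * logL) + (1 + ℓ) ^ 2 ≤
      (c' * (P * Real.exp ℓ / (2 * D * ((j : ℝ) + 1)))) ^ αX +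
        (2 + 8 / ((c' / (2 * D)) ^ αX / 2 * αX ^ 3 / 6) ^ 2) := by
  have hP0 : 0 < P := by linarith
  have hD0 : 0 < D := by linarith
  have hj1 : (0 : ℝ) < (j : ℝ) + 1 := by positivity
  have hNr : (0 : ℝ) < N := by exact_mod_cast hN
  set κX : ℝ := (c' / (2 * D)) ^ αX with hκX
  have hκX0 : 0 < κX := Real.rpow_pos_of_pos (by positivity) αX
  set κ₃ : ℝ := κX / 2 * αX ^ 3 / 6 with hκ₃
  have hκ₃0 : 0 < κ₃ := by positivity
  -- (j+1) ≤ P^{1/N}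
  have hjP1 : ((j : ℝ) + 1) ≤ P ^ ((N : ℝ)⁻¹) := by
    have h := Real.rpow_le_rpow (by positivity) hjP (inv_nonneg.mpr hNr.le)
    rwa [Real.pow_rpow_inv_natCast hj1.le hN.ne'] at h
  -- the base ≥ P^{1-1/N} e^ℓ/(2D)
  have hx1 : 1 ≤ P ^ (1 - 1 / (N : ℝ)) :=
    Real.one_le_rpow hP1 (by rw [sub_nonneg, div_le_one hNr]; exact_mod_cast hN)
  have hy1 : 1 ≤ Real.exp (αX * ℓ) := Real.one_le_exp (by positivity)
  have hbase : c' / (2 * D) * (P ^ (1 - 1 / (N : ℝ)) * Real.exp ℓ) ≤ c' * (P * Real.exp ℓ / (2 * D * ((j : ℝ) + 1))) := by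
    have h1 : P ^ (1 - 1 / (N : ℝ)) * ((j : ℝ) + 1) ≤ P := by
      calc P ^ (1 - 1 / (N : ℝ)) * ((j : ℝ) + 1) ≤ P ^ (1 - 1 / (N : ℝ)) * P ^ ((N : ℝ)⁻¹) :=
            mul_le_mul_of_nonneg_left hjP1 (by positivity)
        _ = P := by rw [← Real.rpow_add hP0, inv_eq_one_div, sub_add_cancel, Real.rpow_one]
    have heq : c' * (P * Real.exp ℓ / (2 * D * ((j : ℝ) + 1))) = c' / (2 * D) * (P * Real.exp ℓ / ((j : ℝ) + 1)) := by
      field_simp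
    rw [heq]
    refine mul_le_mul_of_nonneg_left ?_ (by positivity)
    rw [le_div_iff₀ hj1]
    calc P ^ (1 - 1 / (N : ℝ)) * Real.exp ℓ * ((j : ℝ) + 1) = (P ^ (1 - 1 / (N : ℝ)) * ((j : ℝ) + 1)) * Real.exp ℓ := by
          ring
      _ ≤ P * Real.exp ℓ := mul_le_mul_of_nonneg_right h1 (Real.exp_nonneg _)
  have hbase0 : 0 ≤ c' / (2 * D) * (P ^ (1 - 1 / (N : ℝ)) * Real.exp ℓ) := by positivity
  have hpow := Real.rpow_le_rpow hbase0 hbase hαX.le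
  have hlhs : (c' / (2 * D) * (P ^ (1 - 1 / (N : ℝ)) * Real.exp ℓ)) ^ αX =
      κX * (P ^ (αX * (1 - 1 / N)) * Real.exp (αX * ℓ)) := by
    rw [Real.mul_rpow (by positivity) (by positivity), Real.mul_rpow (by positivity) (by positivity),
      ← Real.rpow_mul hP0.le, ← Real.exp_mul, mul_comm (1 - 1 / (N : ℝ)) αX, mul_comm ℓ αX]
  rw [hlhs] at hpow
  -- split the product: `x y ≥ (x + y)/2` for `x, y ≥ 1`
  have hxy : κX / 2 * P ^ (αX * (1 - 1 / N)) + κX / 2 * Real.exp (αX * ℓ) ≤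
      κX * (P ^ (αX * (1 - 1 / N)) * Real.exp (αX * ℓ)) := by
    have hx1' : 1 ≤ P ^ (αX * (1 - 1 / (N : ℝ))) :=
      Real.one_le_rpow hP1 (mul_nonneg hαX.le (by rw [sub_nonneg, div_le_one hNr]; exact_mod_cast hN))
    nlinarith [mul_nonneg (sub_nonneg.mpr hx1') (sub_nonneg.mpr hy1), hκX0]
  -- the polynomial part pays the `j`-entropy
  have hpoly : A' * ((j : ℝ) * logL) ≤ κX / 2 * P ^ (αX * (1 - 1 / N)) := by
    have hsplit : P ^ (αX * (1 - 1 / (N : ℝ))) = P ^ (αX * (1 - 1 / N) - 1 / N) * P ^ ((N : ℝ)⁻¹) := by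
      rw [← Real.rpow_add hP0, inv_eq_one_div, sub_add_cancel]
    rw [hsplit]
    have hjle : (j : ℝ) * logL ≤ logL * P ^ ((N : ℝ)⁻¹) := by
      have : (j : ℝ) ≤ P ^ ((N : ℝ)⁻¹) := by linarith
      nlinarith
    calc A' * ((j : ℝ) * logL) ≤ A' * (logL * P ^ ((N : ℝ)⁻¹)) := mul_le_mul_of_nonneg_left hjle hA'
      _ = (A' * logL) * P ^ ((N : ℝ)⁻¹) := by ring
      _ ≤ (κX / 2 * P ^ (αX * (1 - 1 / N) - 1 / N)) * P ^ ((N : ℝ)⁻¹) :=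
          mul_le_mul_of_nonneg_right hbig (by positivity)
      _ = κX / 2 * (P ^ (αX * (1 - 1 / N) - 1 / N) * P ^ ((N : ℝ)⁻¹)) := by ring
  -- the exponential part pays the log-square rate
  have hexp3 : κ₃ * ℓ ^ 3 ≤ κX / 2 * Real.exp (αX * ℓ) := by
    have h := Real.pow_div_factorial_le_exp (αX * ℓ) (by positivity) 3
    have h6 : ((Nat.factorial 3 : ℕ) : ℝ) = 6 := by norm_num [Nat.factorial]
    rw [h6] at h
    calc κ₃ * ℓ ^ 3 = κX / 2 * ((αX * ℓ) ^ 3 / 6) := by rw [hκ₃]; ring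
      _ ≤ κX / 2 * Real.exp (αX * ℓ) := mul_le_mul_of_nonneg_left h (by positivity)
  have hsq : (1 + ℓ) ^ 2 ≤ 2 + 8 / κ₃ ^ 2 + κ₃ * ℓ ^ 3 := by
    have h2 : (1 + ℓ) ^ 2 ≤ 2 + 2 * ℓ ^ 2 := by nlinarith [sq_nonneg (ℓ - 1)]
    have h3 : 2 * ℓ ^ 2 ≤ κ₃ * ℓ ^ 3 + 8 / κ₃ ^ 2 := by
      by_cases hcase : 2 / κ₃ ≤ ℓ
      · have h4 : 2 ≤ κ₃ * ℓ := by rwa [div_le_iff₀' hκ₃0] at hcase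
        have h5 : 2 * ℓ ^ 2 ≤ κ₃ * ℓ * ℓ ^ 2 := mul_le_mul_of_nonneg_right h4 (sq_nonneg ℓ)
        have h6 : κ₃ * ℓ * ℓ ^ 2 = κ₃ * ℓ ^ 3 := by ring
        have h7 : 0 ≤ 8 / κ₃ ^ 2 := by positivity
        linarith
      · have hlt : ℓ < 2 / κ₃ := not_le.mp hcase
        have h4 : ℓ ^ 2 ≤ (2 / κ₃) ^ 2 := pow_le_pow_left₀ hℓ hlt.le 2
        have h8 : (2 / κ₃) ^ 2 = 4 / κ₃ ^ 2 := by rw [div_pow]; norm_num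
        rw [h8] at h4
        have h9 : 0 ≤ κ₃ * ℓ ^ 3 := by positivity
        have h10 : 2 * ℓ ^ 2 ≤ 8 / κ₃ ^ 2 := by
          have : 8 / κ₃ ^ 2 = 2 * (4 / κ₃ ^ 2) := by ring
          rw [this]; linarith
        linarith
    linarith
  linarith

end Exponent

end Summit.QuantumFields.YangMills.Theorems.RandomisedStokesChaos

end
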